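import Literature.AnabelianGeometry.EtaleTheta.Discharge.Sec4NonVacuityConstantsUnitRoots
import HarnessLib

/-!
# [EtTh] Prop. 4.2 (iv) AS TYPED and its sub-node L06 `ZetaA` FAIL at the toy with constants `ℤˣ = {±1}`:
# a second (unit-conjugate) base-Frobenius pair gives a square root not isomorphic to the standard one

S. Mochizuki, *The étale theta function and its Frobenioid-theoretic manifestations*, Publ. RIMS **45**
(2009) [MochizukiEtTh2009], §4, Prop. 4.2 (iv), statement PDF p.89 L1–12, proof p.90 L12–24 (printed
pp.315–316): «the existence of a `ζ_A` … follows immediately from the uniqueness up to conjugation by a unit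
of base-Frobenius pairs of `A_N`, `Ā_N` [cf. [FrdI], Proposition 5.6] …», the unit being absorbed through «the
"(N, H_⊙, f|_{A_N})-saturated-ness" condition» (p.90 L14–17) — typed as `BiKummerSetting.Prop42_iv` (node
`EtTh:Prop4.2(iv)`) and the sub-node L06 `Prop42Sub.ZetaA` of `plan/L2/SUBDAG-EtTh-Prop42.md` (FACT-LIST row
**F-2799**; abc-iut cell, block F, seat abc-iut-f-130, tranche 130).  [FrdI] = [MochizukiFrdI2008], Def. 2.7
(base-Frobenius pairs), Thm. 5.2 proof p.101.

PROOF-ONLY sequel (0 `def`s) of `Sec4NonVacuityConstants.lean` / `Sec4NonVacuityConstantsUnitRoots.lean`.  Over the toy with an arbitrary constant group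
`C` (one base object, `Φ = ℚ_{≥0}`, `B = C × (ℚ_{≥0})^gp`):
* `ToyCst.exists_twistedFrobeniusSection c` — for every constant `c ∈ C`, L1's zero presection `P` ([FrdI]
  Thm. 5.2 proof) carries the **TWISTED Frobenius-section** `F_c(n)_A := (n, id, 0, c^n·c⁻¹)` (the conjugate of
  the zero section `(n, id, 0, 1)` by the unit `c⁻¹`), and `(P, F_c)` is a GENUINE base-Frobenius pair (REAL
  [FrdI] Def. 2.7 (iii): the base-section half is L1's `isBaseFrobenioid_zero` data, the section half is
  checked here — naturality on `P`-arrows uses that constants pull back to constants);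
* AT `C := ℤˣ`, `c := -1`, `N := 2`: `ToyCst.not_zetaA_and_not_prop42_iv_int` — the fraction-pair `(𝟙, 𝟙)` of
  `f = 1` on `A_⊙` has TWO genuine square roots with `A_N = B_N = A_⊙`, root `1`, pair `(𝟙, 𝟙)`:
  `R` with `α = (2, id, 0, 1)` (zero pair) and `R'` with `ᾱ = (2, id, 0, -1) = F_{-1}(2)_{A_⊙}` (twisted pair),
  both `μ_2`-saturated / `(2, H_⊙, 1)`-saturated with the vacuous `(N,H)`-slot; every `ζ : A_⊙ ⥲ A_⊙` is
  multiplication by a constant `c' = ±1`, and `ζ ≫ ᾱ` has unit component `-c'² = -1 ≠ 1`: so **no `ζ_A` with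
  `ᾱ ∘ ζ_A = α` exists — L06 `ZetaA` and the typed node `Prop42_iv` are FALSE at `ToyCst.biKummerSetting ℤˣ`**
  (model transport); `ToyCst.not_forall_zetaA`, `ToyCst.not_forall_prop42_iv` are the universal-closure forms.

READING (neutral).  With abc-iut-w5-d063's `ToyCov.prop42_iv` (HOLDS at constants `ℂˣ`) this is an
INDEPENDENCE certificate for the typed Prop. 4.2 (iv): over the typed §4 setting data through
`mkOfModelCanonical` with the VACUOUS `(N,H)`-slot it is decided by the arithmetic of the constants.  In print
the two base-Frobenius pairs differ by the unit `-1` and `A_N`, being `(N, H_⊙)`-saturated, contains its square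
roots (p.90 L14–17) — exactly the roots-of-constants input `hL` (GAP-LEDGER G-w4d044-1) of abc-iut-w4-d044's
`zetaA_of_unitRootsUpstairs` / `prop42_iv_mkOfModelCanonical_of_constantRoots`, which the typed setting carries
only through its FREE `(N,H)`-slot; nothing in print is refuted.  F-2799 = SCHEMA: instance PROVED at the roots
reading (`Prop42Sub.zetaA_holds`, p433432) and at `ToyCov`; universal closure REFUTED here.  HONEST LIMITS:
one base object, trivial [FrdI] vocabularies, `Π^tp` trivial over `ℚ̄`, not a curve; consistency ≠
faithfulness; typed ≠ proved.  Nothing here bears on, or takes a side on, [IUTchIII] Cor. 3.12.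
-/

noncomputable section

namespace Literature.AnabelianGeometry.EtaleTheta

open CategoryTheory Opposite Literature.AlgebraicGeometry.Frobenioids
open scoped NNRat

namespace ToyCst

open ToyCov (Base pt deg cover hom_eq aut_eq_one powFunctor catVocab)

section Generic

variable (C : Type) [CommGroup C]

/-- Constants are multiplicative: `cnst (x·y) = cnst x · cnst y`. [cite: MochizukiEtTh2009, Def 3.6 p.77] -/
theorem cnst_mul (A : (temperedFrobenioid C).category) (x y : C) : cnst A (x * y) = cnst A x * cnst A y :=
  congrArg Units.val (map_mul (cnstUnitHom A) x y)

/-- Constants are multiplicative: `cnst (x^k) = (cnst x)^k`. [cite: MochizukiEtTh2009, Def 3.6 p.77] -/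
theorem cnst_pow (A : (temperedFrobenioid C).category) (x : C) (k : ℕ) : cnst A (x ^ k) = cnst A x ^ k := by
  rw [← coe_cnstUnitHom, map_pow, Units.val_pow_eq_pow_val, coe_cnstUnitHom]

/-- `cnst 1 = 1`. [cite: MochizukiEtTh2009, Def 3.6 p.77] -/
theorem cnst_one (A : (temperedFrobenioid C).category) : cnst A (1 : C) = 1 := rfl

/-- Relation (d) of [FrdI] Thm. 5.2 (i) for the data `(n, id, 0, x)` at an object with `cls = 1`, `x` a
constant. [cite: MochizukiFrdI2008, Thm. 5.2(i) p.100] -/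
theorem twist_rel (A : (temperedFrobenioid C).category) (hA : A.cls = 1) (n : ℕ+) (x : C) :
    A.cls ^ (n : ℕ) * Algebra.GrothendieckGroup.of (1 : (temperedFrobenioid C).divisorMonoid.obj (op A.base)) =
      pullGp (temperedFrobenioid C).divisorMonoid (𝟙 _) A.cls *
        divB (temperedFrobenioid C).divisorMonoid (temperedFrobenioid C).ratFnFunctor
          (temperedFrobenioid C).divBNatTrans (op A.base) (cnst A x) := by
  rw [hA, one_pow, map_one, map_one, one_mul, one_mul, ← of_one_eq_divB_cnst, map_one]

/-- Naturality of the twisted Frobenius endomorphisms `(n, id, 0, x)` along the arrows `(1, f, 0, 1)` of L1's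
zero presection (constants pull back to constants). [cite: MochizukiFrdI2008, Thm. 5.2 p.101] -/
theorem twist_naturality {A B : (temperedFrobenioid C).category} (φ : A ⟶ B) (hA : A.cls = 1) (hB : B.cls = 1)
    (hd : ModelFrobenioid.degFr φ = 1) (hv : ModelFrobenioid.div φ = 1) (hu : ModelFrobenioid.unit φ = 1)
    (n : ℕ+) (x : C) :
    φ ≫ ModelFrobenioid.mkHom B B n (𝟙 _) 1 (cnst B x) (twist_rel C B hB n x) =
      ModelFrobenioid.mkHom A A n (𝟙 _) 1 (cnst A x) (twist_rel C A hA n x) ≫ φ := by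
  refine ModelFrobenioid.hom_ext ?_ ?_ ?_ ?_
  · show n * ModelFrobenioid.degFr φ = ModelFrobenioid.degFr φ * n
    rw [mul_comm]
  · show ModelFrobenioid.baseMap φ ≫ 𝟙 _ = 𝟙 _ ≫ ModelFrobenioid.baseMap φ
    rw [Category.comp_id, Category.id_comp]
  · show pull _ (ModelFrobenioid.baseMap φ) 1 * ModelFrobenioid.div φ ^ (n : ℕ) =
      pull _ (𝟙 _) (ModelFrobenioid.div φ) *
        (1 : (temperedFrobenioid C).divisorMonoid.obj (op A.base)) ^ (ModelFrobenioid.degFr φ : ℕ)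
    rw [hv, map_one, map_one, one_pow, one_pow]
  · show pull _ (ModelFrobenioid.baseMap φ) (cnst B x) * ModelFrobenioid.unit φ ^ (n : ℕ) =
      pull _ (𝟙 _) (ModelFrobenioid.unit φ) * cnst A x ^ (ModelFrobenioid.degFr φ : ℕ)
    rw [hu, hd, pull_cnst, one_pow, mul_one, map_one, one_mul, PNat.one_coe, pow_one]

/-- **The twisted base-Frobenius pair.**  For every constant `c ∈ C`, L1's zero presection `P` of the model
Frobenioid ([FrdI] Thm. 5.2 proof: objects `(A_D, 0)`, arrows `(1, f, 0, 1)`) together with the TWISTED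
Frobenius-section `F_c : n ↦ ((n, id, 0, c^n·c⁻¹)_A)_A` — the conjugate of the zero section by the unit `c⁻¹` —
is a GENUINE base-Frobenius pair of the toy Frobenioid with constants `C` (REAL [FrdI] Def. 2.7 (iii)); its
components have Frobenius degree `n`, base `id`, divisor `0` and unit `c^n·c⁻¹`.
[cite: MochizukiFrdI2008, Def. 2.7(iii) p.52] -/
theorem exists_twistedFrobeniusSection (c : C) :
    ∃ Fr : ℕ+ →* End (ModelFrobenioid.zeroPresection (temperedFrobenioid C).divisorMonoid
        (temperedFrobenioid C).ratFnFunctor (temperedFrobenioid C).divBNatTrans).ι,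
      PreFrobenioid.IsBaseFrobeniusPair (temperedFrobenioid C).toElem
          (ModelFrobenioid.zeroPresection _ _ _) Fr ∧
        ∀ (n : ℕ+) (A : (ModelFrobenioid.zeroPresection (temperedFrobenioid C).divisorMonoid
            (temperedFrobenioid C).ratFnFunctor (temperedFrobenioid C).divBNatTrans).Cat),
          ModelFrobenioid.degFr ((Fr n).app A) = n ∧ ModelFrobenioid.baseMap ((Fr n).app A) = 𝟙 _ ∧
            ModelFrobenioid.div ((Fr n).app A) = 1 ∧
              ModelFrobenioid.unit ((Fr n).app A) = cnst A.1 (c ^ (n : ℕ) * c⁻¹) := by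
  let F : ℕ+ → End (ModelFrobenioid.zeroPresection (temperedFrobenioid C).divisorMonoid
      (temperedFrobenioid C).ratFnFunctor (temperedFrobenioid C).divBNatTrans).ι := fun n =>
    { app := fun A => ModelFrobenioid.mkHom A.1 A.1 n (𝟙 _) 1 (cnst A.1 (c ^ (n : ℕ) * c⁻¹))
        (twist_rel C A.1 A.2 n _)
      naturality := fun A B f =>
        twist_naturality C f.1 A.2 B.2 f.2.2.2.1 f.2.2.2.2.1 f.2.2.2.2.2 n _ }
  refine ⟨{ toFun := F, map_one' := ?_, map_mul' := ?_ }, ⟨?_, ?_⟩, fun n A => ⟨rfl, rfl, rfl, rfl⟩⟩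
  · -- `F(1) = id`
    apply NatTrans.ext
    funext A
    refine ModelFrobenioid.hom_ext rfl rfl rfl ?_
    show cnst A.1 (c ^ ((1 : ℕ+) : ℕ) * c⁻¹) = 1
    rw [PNat.one_coe, pow_one, mul_inv_cancel, cnst_one]
  · -- `F(m n) = F(m) ∘ F(n)`
    intro m n
    apply NatTrans.ext
    funext A
    obtain ⟨A, hA⟩ := A
    refine ModelFrobenioid.hom_ext rfl (Category.comp_id _).symm ?_ ?_
    · show (1 : (temperedFrobenioid C).divisorMonoid.obj (op A.base)) =
        pull (temperedFrobenioid C).divisorMonoid (𝟙 A.base) 1 * 1 ^ (m : ℕ)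
      exact ((congrArg₂ (· * ·) (map_one (pull (temperedFrobenioid C).divisorMonoid (𝟙 A.base)))
        (one_pow (M := (temperedFrobenioid C).divisorMonoid.obj (op A.base)) (m : ℕ))).trans (mul_one _)).symm
    · show cnst A (c ^ ((m * n : ℕ+) : ℕ) * c⁻¹) =
        pull _ (𝟙 _) (cnst A (c ^ (m : ℕ) * c⁻¹)) * cnst A (c ^ (n : ℕ) * c⁻¹) ^ (m : ℕ)
      rw [pull_id, ← cnst_pow, ← cnst_mul, PNat.mul_coe]
      congr 1
      rw [mul_pow, ← pow_mul, inv_pow, mul_comm (n : ℕ) (m : ℕ)]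
      group
  · -- `P` is a base-section: L1, for the (skeletal) one-object base
    exact (ModelFrobenioid.isBaseFrobeniusPair_zero (divisorMonoid_isDivisorial C) (ratFnFunctor_isGroupLike C)
      (fun X Y _ => Subsingleton.elim X Y)).isBaseSection
  · -- `F_c` is a `P`-Frobenius-section
    exact
      { degFr_eq := fun _ _ => rfl
        isBaseIdentity := fun _ _ => rfl
        isFrobeniusType := fun _ A =>
          ⟨⟨ModelFrobenioid.isCoAngular (ratFnFunctor_isGroupLike C) _, rfl⟩,
            show IsIso (𝟙 A.1.base) from inferInstance⟩ }

end Generic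

/-! ## `C := ℤˣ`: two non-isomorphic square roots of the fraction-pair `(𝟙, 𝟙)` -/

/-- **L06 `ZetaA` and [EtTh] Prop. 4.2 (iv) AS TYPED are FALSE at the toy with constants `ℤˣ`** (model
transport, vacuous `(N,H)`-slot).  The fraction-pair `(𝟙, 𝟙)` of `f = 1` on `A_⊙` has the two genuine square
roots `R = (A_⊙, A_⊙, α = β = (2, id, 0, 1), 1, (𝟙, 𝟙))` (zero base-Frobenius pair) and
`R' = (A_⊙, A_⊙, ᾱ = β̄ = (2, id, 0, -1), 1, (𝟙, 𝟙))` (twisted base-Frobenius pair `F_{-1}`,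
`exists_twistedFrobeniusSection`); for the base isomorphism `Ā' := id` (so `ᾱ^bs ∘ Ā' = α^bs`) there is NO
`ζ_A : A_⊙ ⥲ A_⊙` with `ᾱ ∘ ζ_A = α`: every `ζ_A` is multiplication by a constant `c' = ±1` and
`u_{ᾱ ∘ ζ_A} = -c'² = -1 ≠ 1 = u_α` ([FrdI] Thm. 5.2 (i)). [cite: MochizukiEtTh2009, Prop 4.2 p.89] -/
theorem not_zetaA_and_not_prop42_iv_int :
    ¬ BiKummerSetting.Prop42Sub.ZetaA (biKummerSetting ℤˣ)
        (fun φ x => (temperedFrobenioid ℤˣ).pullFracModel φ x) ∧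
      ¬ (biKummerSetting ℤˣ).Prop42_iv (fun φ x => (temperedFrobenioid ℤˣ).pullFracModel φ x) := by
  obtain ⟨Fr, hpair, hFr⟩ := exists_twistedFrobeniusSection ℤˣ (-1)
  -- the twisted Frobenius endomorphism `ᾱ = F_{-1}(2)_{A_⊙} = (2, id, 0, -1)`
  obtain ⟨hdeg, hbase, hdiv, hunit⟩ := hFr 2 ⟨Aodot ℤˣ, rfl⟩
  have h1 : ((-1 : ℤˣ) ^ ((2 : ℕ+) : ℕ) * (-1)⁻¹) = -1 := by decide
  have hunit' : ModelFrobenioid.unit ((Fr 2).app ⟨Aodot ℤˣ, rfl⟩) = cnst (Aodot ℤˣ) (-1) :=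
    hunit.trans (congrArg (cnst (Aodot ℤˣ)) h1)
  -- shared data: the fraction-pair `(𝟙, 𝟙)` of `f = 1`
  have hsharp : ∀ x : (temperedFrobenioid ℤˣ).Φ.carrier (op (Aodot ℤˣ).base),
      x ∣ (1 : (temperedFrobenioid ℤˣ).Φ.carrier (op (Aodot ℤˣ).base)) → x = 1 := fun x hx =>
    (divisorMonoid_isDivisorial ℤˣ (Aodot ℤˣ).base).isSharp.eq_one_of_isUnit x (isUnit_of_dvd_one hx)
  let P : (biKummerSetting ℤˣ).FractionPair (1 : (biKummerSetting ℤˣ).biratUnits (Aodot ℤˣ)) (Aodot ℤˣ) :=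
    { num := 𝟙 _
      den := 𝟙 _
      isPreStep_num := ModelFrobenioid.isPreStep_id _
      isPreStep_den := ModelFrobenioid.isPreStep_id _
      base_eq := rfl
      frac_eq := fracOf_id_id ℤˣ (Aodot ℤˣ)
      disjointSupports := fun x hx _ => hsharp x hx }
  have hsat : (biKummerSetting ℤˣ).IsSaturated (Aodot ℤˣ) 2
      ((temperedFrobenioid ℤˣ).pullFracModel (𝟙 (Aodot ℤˣ)) 1) :=
    { isAmple := isAmple_Aodot ℤˣ
      fixed := fun σ _ => by
        change (temperedFrobenioid ℤˣ).biratAutModel (Aodot ℤˣ) σ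
          ((temperedFrobenioid ℤˣ).pullFracModel (𝟙 (Aodot ℤˣ)) 1) =
            (temperedFrobenioid ℤˣ).pullFracModel (𝟙 (Aodot ℤˣ)) 1
        rw [(temperedFrobenioid ℤˣ).biratAutModel_eq_one_of_mem_units
          ⟨(mem_units (Aodot ℤˣ) σ).1, (mem_units (Aodot ℤˣ) σ).2⟩]
        rfl
      cond_a := ⟨Aodot ℤˣ, Aodot ℤˣ, 𝟙 _, 𝟙 _, ModelFrobenioid.isPreStep_id _,
        ModelFrobenioid.isPreStep_id _, isFrobeniusTrivial_Aodot ℤˣ, trivial⟩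
      cond_b := ⟨1, by rw [one_pow]; exact (map_one _).symm⟩ }
  -- `Gal`-clause (b) for `G = 1` over the one-object base
  have hbij : ∀ γ : Aodot ℤˣ ⟶ Aodot ℤˣ,
      Set.BijOn ((biKummerSetting ℤˣ).autBase (Aodot ℤˣ)) ((⊥ : Subgroup (Aut (Aodot ℤˣ))) : Set (Aut (Aodot ℤˣ)))
        ((biKummerSetting ℤˣ).galOver γ : Set (Aut (Aodot ℤˣ).base)) := fun γ => by
    refine ⟨fun σ hσ => ?_, fun σ hσ τ hτ _ => ?_,
      fun τ _ => ⟨1, (⊥ : Subgroup (Aut (Aodot ℤˣ))).one_mem, ?_⟩⟩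
    · have hσ' : σ = 1 := hσ
      subst hσ'
      rw [map_one]
      exact one_mem _
    · exact (show σ = 1 from hσ).trans (show τ = 1 from hτ).symm
    · rw [map_one]
      exact (aut_eq_one _ τ).symm
  -- the STANDARD square root `R` (zero base-Frobenius pair, `α = (2, id, 0, 1)`)
  let d : (biKummerSetting ℤˣ).BaseFrobeniusTypeData (ModelFrobenioid.zeroFrob (Aodot ℤˣ) rfl 2) :=
    { G := ⊥
      G_le := bot_le
      α₂ := ModelFrobenioid.zeroFrob (Aodot ℤˣ) rfl 2
      α₁ := 𝟙 _
      fac := Category.comp_id _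
      isFrobeniusTrivial := isFrobeniusTrivial_Aodot ℤˣ
      isGalois := trivial
      isMuSaturated := isMuSaturated_two_int (Aodot ℤˣ)
      mapsIsomorphically := hbij _
      cond_c := ⟨rfl, ⟨ModelFrobenioid.isCoAngular (ratFnFunctor_isGroupLike ℤˣ) _, rfl⟩,
        show IsIso (𝟙 (ModelFrobenioid.base (Aodot ℤˣ))) from inferInstance⟩
      cond_d := ModelFrobenioid.isPullbackMorphism_of (divisorMonoid_isDivisorial ℤˣ)
        (ratFnFunctor_isGroupLike ℤˣ) rfl rfl
      cond_e := by
        refine ⟨ModelFrobenioid.zeroPresection _ _ _, ModelFrobenioid.zeroFrobeniusSection _ _ _,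
          ModelFrobenioid.isBaseFrobeniusPair_zero (divisorMonoid_isDivisorial ℤˣ) (ratFnFunctor_isGroupLike ℤˣ)
            (fun X Y _ => Subsingleton.elim X Y),
          fun γ hγ => ?_, ⟨rfl, rfl, rfl, rfl, rfl⟩, ⟨rfl, 2, rfl⟩⟩
        have hγ' : γ = 1 := hγ
        subst hγ'
        exact ⟨rfl, rfl, rfl, rfl, rfl⟩ }
  let R : (biKummerSetting ℤˣ).NthRoot (1 : (biKummerSetting ℤˣ).biratUnits (Aodot ℤˣ)) P 2
      (fun φ x => (temperedFrobenioid ℤˣ).pullFracModel φ x) :=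
    { AN := Aodot ℤˣ
      BN := Aodot ℤˣ
      α := ModelFrobenioid.zeroFrob (Aodot ℤˣ) rfl 2
      β := ModelFrobenioid.zeroFrob (Aodot ℤˣ) rfl 2
      root := 1
      pair := P
      comm_num := (Category.id_comp _).trans (Category.comp_id _).symm
      comm_den := (Category.id_comp _).trans (Category.comp_id _).symm
      isIsometry := ⟨rfl, rfl, rfl, rfl⟩
      αData := d
      pow_root := by rw [one_pow]; exact (map_one _).symm
      isSaturated := hsat }
  -- the TWISTED square root `R'` (twisted base-Frobenius pair, `ᾱ = F_{-1}(2)_{A_⊙} = (2, id, 0, -1)`)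
  let d' : (biKummerSetting ℤˣ).BaseFrobeniusTypeData ((Fr 2).app ⟨Aodot ℤˣ, rfl⟩) :=
    { G := ⊥
      G_le := bot_le
      α₂ := (Fr 2).app ⟨Aodot ℤˣ, rfl⟩
      α₁ := 𝟙 _
      fac := Category.comp_id _
      isFrobeniusTrivial := isFrobeniusTrivial_Aodot ℤˣ
      isGalois := trivial
      isMuSaturated := by
        rw [show (biKummerSetting ℤˣ).degFr ((Fr 2).app ⟨Aodot ℤˣ, rfl⟩) = 2 from hdeg]
        exact isMuSaturated_two_int (Aodot ℤˣ)
      mapsIsomorphically := hbij _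
      cond_c := ⟨hbase, ⟨ModelFrobenioid.isCoAngular (ratFnFunctor_isGroupLike ℤˣ) _, hdiv⟩, by
        change IsIso (ModelFrobenioid.baseMap ((Fr 2).app ⟨Aodot ℤˣ, rfl⟩))
        rw [hbase]
        infer_instance⟩
      cond_d := ModelFrobenioid.isPullbackMorphism_of (divisorMonoid_isDivisorial ℤˣ)
        (ratFnFunctor_isGroupLike ℤˣ) rfl rfl
      cond_e := by
        refine ⟨ModelFrobenioid.zeroPresection _ _ _, Fr, hpair, fun γ hγ => ?_, ⟨rfl, rfl, rfl, rfl, rfl⟩,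
          ⟨rfl, 2, rfl⟩⟩
        have hγ' : γ = 1 := hγ
        subst hγ'
        exact ⟨rfl, rfl, rfl, rfl, rfl⟩ }
  let R' : (biKummerSetting ℤˣ).NthRoot (1 : (biKummerSetting ℤˣ).biratUnits (Aodot ℤˣ)) P 2
      (fun φ x => (temperedFrobenioid ℤˣ).pullFracModel φ x) :=
    { AN := Aodot ℤˣ
      BN := Aodot ℤˣ
      α := (Fr 2).app ⟨Aodot ℤˣ, rfl⟩
      β := (Fr 2).app ⟨Aodot ℤˣ, rfl⟩
      root := 1
      pair := P
      comm_num := (Category.id_comp _).trans (Category.comp_id _).symm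
      comm_den := (Category.id_comp _).trans (Category.comp_id _).symm
      isIsometry := ⟨hdiv, hdiv, hdeg, hdeg⟩
      αData := d'
      pow_root := by rw [one_pow]; exact (map_one _).symm
      isSaturated := hsat }
  -- KEY: no `ζ : A_⊙ ⥲ A_⊙` satisfies `ζ ≫ ᾱ = α` (units: `-c'² = -1 ≠ 1`)
  have key : ∀ ζ : Aodot ℤˣ ≅ Aodot ℤˣ,
      ζ.hom ≫ (Fr 2).app ⟨Aodot ℤˣ, rfl⟩ ≠ ModelFrobenioid.zeroFrob (Aodot ℤˣ) rfl 2 := by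
    intro ζ hζ
    obtain ⟨c', rfl⟩ := exists_eq_coefAut (Aodot ℤˣ) ⟨(mem_units (Aodot ℤˣ) ζ).1, (mem_units (Aodot ℤˣ) ζ).2⟩
    have hu := congrArg ModelFrobenioid.unit hζ
    rw [ModelFrobenioid.unit_comp_pull, (coefAut_mem_units (Aodot ℤˣ) c').1, pull_id, hunit', hdeg,
      unit_coefAut_hom, ← cnst_pow, ← cnst_mul] at hu
    have hu' : cnst (Aodot ℤˣ) (-1 * c' ^ ((2 : ℕ+) : ℕ)) = cnst (Aodot ℤˣ) 1 := hu
    have hc : (-1 : ℤˣ) * c' ^ ((2 : ℕ+) : ℕ) = 1 :=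
      cnstUnitHom_injective (Aodot ℤˣ) (Units.ext (by rw [coe_cnstUnitHom, coe_cnstUnitHom]; exact hu'))
    have hc2 : c' ^ ((2 : ℕ+) : ℕ) = 1 := Int.units_sq c'
    rw [hc2, mul_one] at hc
    exact absurd hc (by decide)
  have hbs : (biKummerSetting ℤˣ).base.map R.α = (Iso.refl _).hom ≫ (biKummerSetting ℤˣ).base.map R'.α := by
    change ModelFrobenioid.baseMap (ModelFrobenioid.zeroFrob (Aodot ℤˣ) rfl 2) =
      𝟙 _ ≫ ModelFrobenioid.baseMap ((Fr 2).app ⟨Aodot ℤˣ, rfl⟩)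
    rw [hbase, Category.comp_id]
    rfl
  refine ⟨fun h => ?_, fun h => ?_⟩
  · obtain ⟨ζA, hζ, -⟩ := h 1 P 2 R R' (Iso.refl _) hbs
    exact key ζA hζ
  · obtain ⟨-, ζA, -, -, -, hζ, -, -⟩ := h 1 P 2 R R' (Iso.refl _) hbs
    exact key ζA hζ

/-- **F-2799 · the universal closure of L06 `ZetaA` is FALSE** (over the §4 settings of the toy's type signature
and all transports). [cite: MochizukiEtTh2009, Prop 4.2 p.90] -/
theorem not_forall_zetaA :
    ¬ ∀ (S : BiKummerSetting Toy.temperedGroup (realified ℤˣ) Base catVocab)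
        (pullFrac : ∀ {A A' : S.C} (_ : A' ⟶ A), S.biratUnits A → S.biratUnits A'),
      BiKummerSetting.Prop42Sub.ZetaA S pullFrac :=
  fun h => not_zetaA_and_not_prop42_iv_int.1
    (h (biKummerSetting ℤˣ) fun φ x => (temperedFrobenioid ℤˣ).pullFracModel φ x)

/-- **The universal closure of the typed node [EtTh] Prop. 4.2 (iv) (`BiKummerSetting.Prop42_iv`) is FALSE**:
it fails at `ToyCst.biKummerSetting ℤˣ` with the model transport — while it HOLDS at constants `ℂˣ`
(abc-iut-w5-d063's `ToyCov.prop42_iv`): the typed Prop. 4.2 (iv) is independent of the typed §4 setting data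
with the vacuous `(N,H)`-slot; its missing input is the `(N, H_⊙)`-saturation content (GAP-LEDGER G-w4d044-1).
[cite: MochizukiEtTh2009, Prop 4.2 p.89] -/
theorem not_forall_prop42_iv :
    ¬ ∀ (S : BiKummerSetting Toy.temperedGroup (realified ℤˣ) Base catVocab)
        (pullFrac : ∀ {A A' : S.C} (_ : A' ⟶ A), S.biratUnits A → S.biratUnits A'),
      S.Prop42_iv pullFrac :=
  fun h => not_zetaA_and_not_prop42_iv_int.2
    (h (biKummerSetting ℤˣ) fun φ x => (temperedFrobenioid ℤˣ).pullFracModel φ x)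

end ToyCst

end Literature.AnabelianGeometry.EtaleTheta

end
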